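import Literature.IUT.LogVolume.GenuineThetaFieldTateRoot
import Literature.NumberTheory.NumberFields.PrimitiveRootRamificationProofs
import Literature.NumberTheory.EllipticCurves.WeilPairingRootsOfUnityHolds
import HarnessLib

/-!
# The `F`-layer of a genuine Θ-volume datum contains `μ₃₀`; hence `2 ∣ e(w | 3)` and `4 ∣ e(w | 5)` at every place over `3`, `5`
# (Stage 2a′ of the WILD local type, abc-iut R-W GAP G-Wnum2-1; proof-only)

Mochizuki, *Inter-universal Teichmüller theory IV*, Thm. 1.10 p. 22 (the `30`-torsion of `E_F` is `F`-rational: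
`Cor22.ThetaVolumeDatumAt.torsion_thirty_rational`); Silverman, *AEC* Cor. III.8.1.1 (rational full `m`-torsion forces
`μ_m ⊂ F` via the Weil pairing; the tree's `exists_isPrimitiveRoot_of_card_torsionBy_eq_sq_holds`) and Cor. III.6.4 (b)
(`#E[m] = m²`, the tree's `card_torsionBy_eq_sq`); Washington, *Introduction to Cyclotomic Fields*, Lemma 1.4 / Prop. 2.1
(`p` totally ramified in `ℚ(ζ_p)`; this seat's `sub_one_dvd_ramificationIdx_of_isPrimitiveRoot`).

* `ThetaVolumeDatumAt.natCard_torsionBy_F_eq_sq` — `#E_F(F)[n] = n²` for `0 < n ∣ 30`;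
* `ThetaVolumeDatumAt.exists_isPrimitiveRoot_F` — `ζ_p ∈ F` for every prime `p ∣ 30`;
* **`ThetaVolumeDatumAt.sub_one_dvd_ramificationIdx_int`** — `(p − 1) ∣ e(w | p)` for every place `w` of `F` over a prime
  `p ∣ 30`: `2 ∣ e(w | 3)`, `4 ∣ e(w | 5)` — the cyclotomic factor of the wild local type `e(F_w/ℚ_p) = e_W·r`
  (`e_W = e(ℚ_p(ζ_p, q^{1/p})/ℚ_p) ∈ {p(p−1), p−1}`, abc-iut W-num-2 N1-WILD-EXACT §1). With Stage 2a
  (`fifteen_dvd_ramificationIdx_mul`) this yields the EXACT value `p(p−1)·r` as a LOWER bound whenever `gcd(15, t) = 1`.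

Proof-only (no definition, no named fact); inputs BY NAME; classical; TAKES NO SIDE on [IUTchIII] Cor. 3.12.
[cite: Mochizuki2012, IUTchIV Thm. 1.10 p. 22] [cite: SilvermanAEC2009, Cor. III.8.1.1] [cite: Washington1997, Lemma 1.4 and Prop. 2.1]
[claim: Mochizuki2012, status: disputed] for every IUT quotation.
-/

noncomputable section

open scoped Classical

namespace Literature.IUT.LogVolume

namespace Cor22

namespace ThetaVolumeDatumAt

open NumberField IsDedekindDomain Literature.NumberTheory.DiophantineGeometry.GenEll
open Literature.NumberTheory.EllipticCurves Literature.NumberTheory.NumberFields Literature.IUT.HodgeTheaters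
open WeierstrassCurve Field

variable {P : NFPoint} {l : ℕ} (T : ThetaVolumeDatumAt P l)

/-- **`#E_F(F)[n] = n²` for `0 < n ∣ 30`**: the rational `n`-torsion maps bijectively onto the geometric `n`-torsion
(`torsion_thirty_rational`; Silverman III.6.4 (b) over `F̄`). [cite: Mochizuki2012, IUTchIV Thm. 1.10 p. 22]
[cite: SilvermanAEC2009, Cor. III.6.4(b)] [claim: Mochizuki2012, status: disputed] -/
theorem natCard_torsionBy_F_eq_sq {n : ℕ} (hn0 : 0 < n) (hn : n ∣ 30) :
    letI := T.instFieldF; letI := T.instNumberFieldF; letI := T.instIsElliptic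
    Nat.card (AddSubgroup.torsionBy T.E.toAffine.Point (n : ℤ)) = n ^ 2 := by
  letI := T.instFieldF; letI := T.instNumberFieldF; letI := T.instAlgebraF; letI := T.instFieldK
  letI := T.instNumberFieldK; letI := T.instAlgebraK; letI := T.instFieldFbar; letI := T.instAlgebraFbar
  letI := T.instAlgebraKFbar; letI := T.instIsElliptic
  haveI := T.D.isAlgClosure
  haveI : IsAlgClosed T.Fbar := IsAlgClosure.isAlgClosed T.F
  haveI : (T.E.baseChange T.Fbar).IsElliptic := inferInstanceAs (T.E.map (algebraMap T.F T.Fbar)).IsElliptic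
  haveI : CharZero T.Fbar := charZero_of_injective_algebraMap (algebraMap T.F T.Fbar).injective
  -- `E_F(F) → E_F(F̄)` (the points of `E_F` over `F` ARE the points of `E_F ⊗_F F`, definitionally)
  set ι : (T.E.toAffine.baseChange T.F).Point →+ (T.E.toAffine.baseChange T.Fbar).Point :=
    Affine.Point.baseChange (W' := T.E.toAffine) T.F T.Fbar with hι
  have hιinj : Function.Injective ι := Affine.Point.map_injective _
  set A : Set (T.E.toAffine.baseChange T.F).Point := {Q | n • Q = 0} with hA
  have hAeq : (AddSubgroup.torsionBy T.E.toAffine.Point (n : ℤ) : Set T.E.toAffine.Point) = A := by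
    ext Q
    change Q ∈ AddSubgroup.torsionBy _ (n : ℤ) ↔ n • Q = 0
    exact AddSubgroup.torsionBy.nsmul_iff
  have himage : ι '' A = (AddSubgroup.torsionBy (GeomPoints T.Fbar T.E) (n : ℤ) : Set (GeomPoints T.Fbar T.E)) := by
    ext R
    constructor
    · rintro ⟨Q, hQ, rfl⟩
      change ι Q ∈ AddSubgroup.torsionBy _ (n : ℤ)
      rw [AddSubgroup.torsionBy.nsmul_iff, ← map_nsmul, show n • Q = 0 from hQ, map_zero]
    · intro hR
      change R ∈ AddSubgroup.torsionBy _ (n : ℤ) at hR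
      rw [AddSubgroup.torsionBy.nsmul_iff] at hR
      have hRz : (n : ℤ) • R = 0 := by rw [natCast_zsmul]; exact hR
      have h30 : (30 : ℤ) • R = 0 := by
        obtain ⟨m, hm⟩ := hn
        have h30eq : (30 : ℤ) = (m : ℤ) * (n : ℤ) := by
          have := congrArg (Nat.cast : ℕ → ℤ) hm
          push_cast at this
          linarith
        rw [h30eq, mul_smul, hRz, smul_zero]
      obtain ⟨Q, hQ⟩ := T.torsion_thirty_rational R h30
      refine ⟨Q, ?_, hQ⟩
      change n • Q = 0
      apply hιinj
      rw [map_nsmul, hQ, map_zero, hR]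
  have hcardB : (AddSubgroup.torsionBy (GeomPoints T.Fbar T.E) (n : ℤ) : Set (GeomPoints T.Fbar T.E)).ncard = n ^ 2 := by
    rw [← Nat.card_coe_set_eq]
    have hnF : ((n : ℕ) : T.Fbar) ≠ 0 := by exact_mod_cast hn0.ne'
    exact card_torsionBy_eq_sq (E := T.E.baseChange T.Fbar) hnF
  have hcardA : A.ncard = n ^ 2 := by
    rw [← Set.ncard_image_of_injective A hιinj, himage, hcardB]
  change Nat.card ((AddSubgroup.torsionBy T.E.toAffine.Point (n : ℤ) : Set T.E.toAffine.Point)) = n ^ 2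
  rw [Nat.card_coe_set_eq, hAeq]
  exact hcardA

/-- **`ζ_p ∈ F` for every prime `p ∣ 30`**: the `p`-torsion of `E_F` is fully `F`-rational (`p²` points), so the Weil
pairing puts a primitive `p`-th root of unity in `F` (Silverman III.8.1.1). [cite: SilvermanAEC2009, Cor. III.8.1.1]
[cite: Mochizuki2012, IUTchIV Thm. 1.10 p. 22] [claim: Mochizuki2012, status: disputed] -/
theorem exists_isPrimitiveRoot_F {p : ℕ} (hp : p.Prime) (hp30 : p ∣ 30) :
    letI := T.instFieldF
    ∃ ζ : T.F, IsPrimitiveRoot ζ p := by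
  letI := T.instFieldF; letI := T.instNumberFieldF; letI := T.instIsElliptic
  have h2 : 2 ≤ p := hp.two_le
  have hpF : (p : T.F) ≠ 0 := by exact_mod_cast hp.ne_zero
  exact T.E.exists_isPrimitiveRoot_of_card_torsionBy_eq_sq_holds p h2 hpF (T.natCard_torsionBy_F_eq_sq hp.pos hp30)

/-- **`(p − 1) ∣ e(w | p)` for every place `w` of `F` over a prime `p ∣ 30`** (`2 ∣ e(w|3)`, `4 ∣ e(w|5)`): `ζ_p ∈ F` and
`p` is totally ramified in `ℚ(ζ_p)` (this seat's `sub_one_dvd_ramificationIdx_of_isPrimitiveRoot`).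
[cite: Washington1997, Lemma 1.4 and Prop. 2.1] [cite: Mochizuki2012, IUTchIV Thm. 1.10 p. 22] [claim: Mochizuki2012, status: disputed] -/
theorem sub_one_dvd_ramificationIdx_int {p : ℕ} (hp : p.Prime) (hp30 : p ∣ 30)
    (w : letI := T.instFieldF; letI := T.instNumberFieldF; HeightOneSpectrum (𝓞 T.F))
    (hw : letI := T.instFieldF; letI := T.instNumberFieldF; ((p : ℕ) : 𝓞 T.F) ∈ w.asIdeal) :
    (p - 1) ∣ (letI := T.instFieldF; letI := T.instNumberFieldF; w.asIdeal.ramificationIdx ℤ) := by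
  letI := T.instFieldF; letI := T.instNumberFieldF
  obtain ⟨ζ, hζ⟩ := T.exists_isPrimitiveRoot_F hp hp30
  exact sub_one_dvd_ramificationIdx_of_isPrimitiveRoot hp hζ w hw

end ThetaVolumeDatumAt

end Cor22

end Literature.IUT.LogVolume

end
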